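import Mathlib
import HarnessLib
import Literature.Analysis.FluidPDE.TypeIAncientMildClassical
import Summits.NavierStokesRegularity.NavierStokesRegularity.Theorems.LocalHelicityTubeDoorFrobeniusProfileRigidityHeadMonotone
import Summits.NavierStokesRegularity.NavierStokesRegularity.Theorems.LocalSineTubeDoorProfileAlignedWindowRigidityAncient
import Summits.NavierStokesRegularity.NavierStokesRegularity.Theorems.PoloidalWindowDoorPoloidalWindowRigidityWindow
import Summits.NavierStokesRegularity.NavierStokesRegularity.Theorems.PoloidalWindowDoorPoloidalWindowRigidityFlat
import Summits.NavierStokesRegularity.NavierStokesRegularity.Theorems.LocalSineTubeDoorBoundedSubsolutionMaxPrinciple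

/-!
# The one-window door family — the SUB-CRITICAL ENERGY SUB-SOLUTION PRINCIPLE for the Type-I profile class,
# and the sub-critical HEAD stratum («Type-I blow-up must feed kinetic energy at the critical rate»)

Cell ns-regularity-ideate, seat p6 (route-directed support for nsreg-p1's door family; bears_on LADDER-NS N0; anchor
`--supports stmt-NavierStokesRegularity-20018`, the profile-rigidity item of the family).  One wrapper behind the signed
strata of this cycle (`…PressureWorkLiouville.eq_zero_of_pressureWork_ge`, ns-helicity-19975-w1's
`…HeadMonotone.eq_zero_of_head_nondecreasing` / `eq_zero_of_pressure_nondecreasing`, which are its `κ = 0` cases):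

* `eq_zero_of_subcritical_normSq` — **if `q = |v|²` satisfies `∂ₜq + Dq(b) − Δq ≤ 2κ q/(−t)` pointwise on the open
  past for some drift `b` bounded on every slab `(−∞, t₁]`, `t₁ < 0`, and some `κ < ½`, then `v ≡ 0`** for every profile
  of the family's Type-I class: the weighted density `w = (−t)^β q`, `β = max(2κ, 0) < 1`, satisfies
  `∂ₜw + Dw(b) − Δw ≤ (2κ − β)(−t)^{β−1} q ≤ 0`, is bounded by `C²(−t₁)^{β−1}` on `[t₀, t₁] × ℝ³` and starts below
  `C²(−t₀)^{β−1} → 0` (`t₀ → −∞`, because `β < 1`), so the whole-space maximum principle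
  (`le_of_bounded_subsolution`) forces `w ≡ 0`.  The threshold `½` is the criticality of the rate `|v|² ≤ C²/(−t)`.
* `eq_zero_of_subcritical_head` — **SUB-CRITICAL HEAD STRATUM**: if `(−s)⟪v, ∂ₜv − Δv⟫ ≤ κ|v|²` pointwise for some
  `κ < ½` — for any classical pressure, `(−s)·v·∇(p + |v|²/2) ≥ −κ|v|²`: the head may DECREASE along streamlines, but
  only sub-critically — then `v ≡ 0` (drift `b = 0`; w1's `hasDerivAt_normSq` for `∂ₜ|v|² = 2⟪v, ∂ₜv⟫` and
  `Δ|v|² = 2⟪Δv, v⟫ + 2|Dv|²_F`).  `κ = 0` is w1's head-monotone stratum.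

No window door is attached (inequalities do not spread by analyticity).

WHAT THIS IS NOT: not a claim about Navier–Stokes regularity (Clay A) — a settled signed stratum of the family's
profile class and the wrapper behind it; establishment in the cell's sense still requires the cross-family referee
PASS + independent reproduction.
-/

noncomputable section

-- the summit and its single sub-problem share the name (CONVENTIONS §1), as in every Theorems file
set_option linter.dupNamespace false

namespace Summit.NavierStokesRegularity.NavierStokesRegularity.Theorems.LocalTraceTubeDoorSubcriticalEnergy

open MeasureTheory Set Function Filter Topology TopologicalSpace Metric InnerProductSpace
open scoped RealInnerProductSpace InnerProductSpace Laplacian ContDiff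
open Literature.Analysis Literature.Analysis.FluidPDE
open Summit.NavierStokesRegularity.NavierStokesRegularity.Theorems.LocalHelicityTubeDoorFrobeniusProfileRigidityHeadMonotone
open Summit.NavierStokesRegularity.NavierStokesRegularity.Theorems.LocalSineTubeDoorProfileAlignedWindowRigidityAncient
open Summit.NavierStokesRegularity.NavierStokesRegularity.Theorems.PoloidalWindowDoorPoloidalWindowRigidityWindow
open Summit.NavierStokesRegularity.NavierStokesRegularity.Theorems.PoloidalWindowDoorPoloidalWindowRigidityFlat
open Summit.NavierStokesRegularity.NavierStokesRegularity.Theorems.LocalSineTubeDoorBoundedSubsolutionMaxPrinciple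

variable {C : ℝ} {v : ℝ → EuclideanSpace ℝ (Fin 3) → EuclideanSpace ℝ (Fin 3)}

/-- **THE SUB-CRITICAL ENERGY SUB-SOLUTION PRINCIPLE.**  See the module docstring. -/
theorem eq_zero_of_subcritical_normSq (hrate : HasTypeITimeDecay C v)
    (hcont : ContinuousOn (uncurry v) (Iio (0 : ℝ) ×ˢ univ))
    (hmild : ∀ s t : ℝ, s < t → t < 0 → ∀ x,
      v t x = UnboundedOperators.heatExtension (v s) (t - s) x - oseenDuhamel 1 s v v t x)
    (hdiv : ∀ t < 0, VectorCalculus.IsDivFree (v t))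
    {b : ℝ → EuclideanSpace ℝ (Fin 3) → EuclideanSpace ℝ (Fin 3)}
    (hb : ∀ t₁ < 0, ∃ A : ℝ, ∀ t ≤ t₁, ∀ x, ‖b t x‖ ≤ A) {κ : ℝ} (hκ : κ < 1 / 2)
    (hsub : ∀ t < 0, ∀ x,
      HasDerivAt (fun τ => ⟪v τ x, v τ x⟫_ℝ) (deriv (fun τ => ⟪v τ x, v τ x⟫_ℝ) t) t ∧
        deriv (fun τ => ⟪v τ x, v τ x⟫_ℝ) t + fderiv ℝ (fun y => ⟪v t y, v t y⟫_ℝ) x (b t x) -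
          (Δ (fun y => ⟪v t y, v t y⟫_ℝ)) x ≤ 2 * κ / (-t) * ⟪v t x, v t x⟫_ℝ) :
    ∀ t < 0, ∀ x, v t x = 0 := by
  have hA : IsTypeIAncientMild C v := isTypeIAncientMild_of_class hrate hcont hmild hdiv
  have hsm : IsSmoothSpaceTimeOn (Iio 0) v := hA.contDiffOn
  -- the exponent
  set β : ℝ := max (2 * κ) 0 with hβ
  have hβ0 : 0 ≤ β := le_max_right _ _
  have hβκ : 2 * κ ≤ β := le_max_left _ _
  have hβ1 : β < 1 := max_lt (by linarith) one_pos
  set q : ℝ → EuclideanSpace ℝ (Fin 3) → ℝ := fun τ y => ⟪v τ y, v τ y⟫_ℝ with hqdef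
  set w : ℝ → EuclideanSpace ℝ (Fin 3) → ℝ := fun τ y => (-τ) ^ β * ⟪v τ y, v τ y⟫_ℝ with hwdef
  set wt : ℝ → EuclideanSpace ℝ (Fin 3) → ℝ := fun τ y => deriv (fun τ' => w τ' y) τ with hwtdef
  have hq0 : ∀ t x, 0 ≤ q t x := fun t x => real_inner_self_nonneg
  -- the weighted sub-solution property at every point of the open past
  have hwsub : ∀ t < 0, ∀ x, HasDerivAt (fun τ => w τ x) (wt t x) t ∧
      wt t x + fderiv ℝ (w t) x (b t x) - (Δ (w t)) x ≤ 0 := by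
    intro t ht x
    have hnt : 0 < -t := neg_pos.2 ht
    obtain ⟨hqd, hineq⟩ := hsub t ht x
    have hv2 : ContDiff ℝ 2 (v t) := contDiff_infty.1 (hsm.contDiff_slice ht) 2
    have hq2 : ContDiff ℝ 2 (fun y => ⟪v t y, v t y⟫_ℝ) := hv2.inner ℝ hv2
    have hqdx : DifferentiableAt ℝ (fun y => ⟪v t y, v t y⟫_ℝ) x := (hq2.differentiable (by norm_num)) x
    have hpow : HasDerivAt (fun τ => (-τ) ^ β) (-1 * β * (-t) ^ (β - 1)) t := by
      have h := (hasDerivAt_neg t).rpow_const (p := β) (Or.inl hnt.ne')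
      simpa using h
    have hwd : HasDerivAt (fun τ => (-τ) ^ β * ⟪v τ x, v τ x⟫_ℝ)
        (-1 * β * (-t) ^ (β - 1) * ⟪v t x, v t x⟫_ℝ + (-t) ^ β * deriv (fun τ => ⟪v τ x, v τ x⟫_ℝ) t) t :=
      hpow.mul hqd
    refine ⟨hwd.differentiableAt.hasDerivAt, ?_⟩
    have hwt_eq : wt t x = -1 * β * (-t) ^ (β - 1) * ⟪v t x, v t x⟫_ℝ +
        (-t) ^ β * deriv (fun τ => ⟪v τ x, v τ x⟫_ℝ) t := by
      simp only [hwtdef, hwdef]; exact hwd.deriv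
    have hX : fderiv ℝ (w t) x (b t x) = (-t) ^ β * fderiv ℝ (fun y => ⟪v t y, v t y⟫_ℝ) x (b t x) := by
      rw [show w t = fun y => (-t) ^ β • ⟪v t y, v t y⟫_ℝ from rfl, fderiv_fun_const_smul hqdx]
      rfl
    have hL : (Δ (w t)) x = (-t) ^ β * (Δ (fun y => ⟪v t y, v t y⟫_ℝ)) x := by
      have e : w t = (-t) ^ β • fun y => ⟪v t y, v t y⟫_ℝ := by
        funext y; simp [hwdef, smul_eq_mul]
      rw [e, InnerProductSpace.laplacian_smul _ hq2.contDiffAt, smul_eq_mul]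
    rw [hwt_eq, hX, hL]
    set c : ℝ := (-t) ^ β with hc
    set c' : ℝ := (-t) ^ (β - 1) with hc'
    have hc'0 : 0 < c' := Real.rpow_pos_of_pos hnt _
    have hcc' : c = (-t) * c' := by
      rw [hc, hc', show β = β - 1 + 1 by ring, Real.rpow_add hnt, Real.rpow_one]
      ring_nf
    have hQ := hq0 t x
    -- `c · (2κ/(−t)) q = 2κ c' q`
    have htne : t ≠ 0 := ht.ne
    have h2 : c * (2 * κ / (-t) * ⟪v t x, v t x⟫_ℝ) = 2 * κ * c' * ⟪v t x, v t x⟫_ℝ := by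
      rw [hcc']; field_simp
    have h3 : c * (deriv (fun τ => ⟪v τ x, v τ x⟫_ℝ) t + fderiv ℝ (fun y => ⟪v t y, v t y⟫_ℝ) x (b t x) -
        (Δ (fun y => ⟪v t y, v t y⟫_ℝ)) x) ≤ 2 * κ * c' * ⟪v t x, v t x⟫_ℝ := by
      rw [← h2]
      exact mul_le_mul_of_nonneg_left hineq (Real.rpow_nonneg hnt.le _)
    have h4 : (2 * κ - β) * c' * ⟪v t x, v t x⟫_ℝ ≤ 0 :=
      mul_nonpos_of_nonpos_of_nonneg (mul_nonpos_of_nonpos_of_nonneg (by linarith) hc'0.le) hQ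
    nlinarith [h3, h4]
  -- bounds in weighted form
  have hwbd : ∀ t < 0, ∀ x, w t x ≤ C ^ 2 * (-t) ^ (β - 1) := fun t ht x => by
    have hnt : 0 < -t := neg_pos.2 ht
    have h1 := hrate t ht x
    have h2 : ‖v t x‖ ^ 2 ≤ (C / Real.sqrt (-t)) ^ 2 := pow_le_pow_left₀ (norm_nonneg _) h1 2
    rw [div_pow, Real.sq_sqrt hnt.le] at h2
    simp only [hwdef, real_inner_self_eq_norm_sq]
    have h3 : (-t) ^ β * ‖v t x‖ ^ 2 ≤ (-t) ^ β * (C ^ 2 / (-t)) :=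
      mul_le_mul_of_nonneg_left h2 (Real.rpow_nonneg hnt.le _)
    refine h3.trans_eq ?_
    have htne : t ≠ 0 := ht.ne
    rw [show β = β - 1 + 1 by ring, Real.rpow_add hnt, Real.rpow_one, show β - 1 + 1 - 1 = β - 1 by ring]
    field_simp
  have hw0 : ∀ t < 0, ∀ x, 0 ≤ w t x := fun t ht x => by
    simp only [hwdef]
    exact mul_nonneg (Real.rpow_nonneg (neg_pos.2 ht).le _) real_inner_self_nonneg
  intro t₁ ht₁ x₁
  have hkey : ∀ t₀ < t₁, w t₁ x₁ ≤ C ^ 2 * (-t₀) ^ (β - 1) := by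
    intro t₀ ht₀
    have hnt₁ : 0 < -t₁ := neg_pos.2 ht₁
    obtain ⟨A, hA'⟩ := hb t₁ ht₁
    have hbA : ∀ t ∈ Icc t₀ t₁, ∀ x, ‖b t x‖ ≤ A := fun t ht x => hA' t ht.2 x
    have hw_c : ContinuousOn (uncurry w) (Icc t₀ t₁ ×ˢ univ) := by
      have hvc : ContinuousOn (uncurry v) (Icc t₀ t₁ ×ˢ univ) :=
        hcont.mono (prod_mono (fun t ht => lt_of_le_of_lt ht.2 ht₁) Subset.rfl)
      have hq' : ContinuousOn (fun z => ⟪uncurry v z, uncurry v z⟫_ℝ) (Icc t₀ t₁ ×ˢ univ) := hvc.inner hvc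
      have hρ : ContinuousOn (fun z : ℝ × EuclideanSpace ℝ (Fin 3) => (-z.1) ^ β) (Icc t₀ t₁ ×ˢ univ) :=
        (continuous_fst.neg.continuousOn).rpow_const fun z _ => Or.inr hβ0
      refine (hρ.mul hq').congr fun z _ => ?_
      simp only [hwdef, uncurry, Pi.mul_apply]
    have hw2 : ∀ t ∈ Icc t₀ t₁, ContDiff ℝ 2 (w t) := fun t ht => by
      have htn : t < 0 := lt_of_le_of_lt ht.2 ht₁
      have hV : ContDiff ℝ 2 (v t) := contDiff_infty.1 (hsm.contDiff_slice htn) 2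
      exact contDiff_const.mul (hV.inner ℝ hV)
    have hwt' : ∀ x, ∀ t ∈ Icc t₀ t₁, HasDerivAt (fun τ => w τ x) (wt t x) t :=
      fun x t ht => (hwsub t (lt_of_le_of_lt ht.2 ht₁) x).1
    have hlaw : ∀ t ∈ Icc t₀ t₁, ∀ x, wt t x + fderiv ℝ (w t) x (b t x) - (Δ (w t)) x ≤ 0 :=
      fun t ht x => (hwsub t (lt_of_le_of_lt ht.2 ht₁) x).2
    have hbdd : ∀ t ∈ Icc t₀ t₁, ∀ x, |w t x| ≤ C ^ 2 * (-t₁) ^ (β - 1) := fun t ht x => by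
      have htn : t < 0 := lt_of_le_of_lt ht.2 ht₁
      rw [abs_of_nonneg (hw0 t htn x)]
      refine (hwbd t htn x).trans (mul_le_mul_of_nonneg_left ?_ (sq_nonneg C))
      exact Real.rpow_le_rpow_of_nonpos hnt₁ (by linarith [ht.2]) (by linarith)
    have hinit : ∀ x, w t₀ x ≤ C ^ 2 * (-t₀) ^ (β - 1) := fun x => hwbd t₀ (ht₀.trans ht₁) x
    exact le_of_bounded_subsolution ht₀ hbA hw_c hw2 hwt' hlaw hbdd hinit t₁ ⟨ht₀.le, le_rfl⟩ x₁
  have hwle : w t₁ x₁ ≤ 0 := by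
    refine le_of_forall_pos_le_add fun η hη => ?_
    have hγ : 0 < 1 - β := by linarith
    have hlim : Tendsto (fun X : ℝ => C ^ 2 * X ^ (-(1 - β))) atTop (nhds (C ^ 2 * 0)) :=
      (tendsto_rpow_neg_atTop hγ).const_mul (C ^ 2)
    rw [mul_zero] at hlim
    obtain ⟨X, hXη, hXt⟩ := ((hlim.eventually_le_const hη).and (eventually_ge_atTop (-t₁ + 1))).exists
    have ht₀ : -X < t₁ := by linarith
    have h1 := hkey (-X) ht₀
    rw [neg_neg, show β - 1 = -(1 - β) by ring] at h1
    linarith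
  have hnt₁ : 0 < -t₁ := neg_pos.2 ht₁
  have hw00 : w t₁ x₁ = 0 := le_antisymm hwle (hw0 t₁ ht₁ x₁)
  have hq00 : ⟪v t₁ x₁, v t₁ x₁⟫_ℝ = 0 := by
    have hpos : 0 < (-t₁) ^ β := Real.rpow_pos_of_pos hnt₁ _
    have h : (-t₁) ^ β * ⟪v t₁ x₁, v t₁ x₁⟫_ℝ = 0 := hw00
    rcases mul_eq_zero.1 h with h | h
    · exact absurd h hpos.ne'
    · exact h
  exact inner_self_eq_zero.1 hq00

/-- **SUB-CRITICAL HEAD STRATUM**: a profile of the Type-I class with `(−s)⟪v, ∂ₜv − Δv⟫ ≤ κ|v|²` pointwise on the open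
past for some `κ < ½` — for any classical pressure, `(−s)·v·∇(p + |v|²/2) ≥ −κ|v|²` — vanishes identically. -/
theorem eq_zero_of_subcritical_head (hrate : HasTypeITimeDecay C v)
    (hcont : ContinuousOn (uncurry v) (Iio (0 : ℝ) ×ˢ univ))
    (hmild : ∀ s t : ℝ, s < t → t < 0 → ∀ x,
      v t x = UnboundedOperators.heatExtension (v s) (t - s) x - oseenDuhamel 1 s v v t x)
    (hdiv : ∀ t < 0, VectorCalculus.IsDivFree (v t)) {κ : ℝ} (hκ : κ < 1 / 2)
    (hle : ∀ s < 0, ∀ y, (-s) * ⟪v s y, deriv (fun τ => v τ y) s - (Δ (v s)) y⟫_ℝ ≤ κ * ⟪v s y, v s y⟫_ℝ) :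
    ∀ t < 0, ∀ x, v t x = 0 := by
  refine eq_zero_of_subcritical_normSq hrate hcont hmild hdiv (b := fun _ _ => 0)
    (fun t₁ _ => ⟨0, fun t _ x => by simp⟩) hκ fun t ht x => ?_
  obtain ⟨hq, hderiv, hL⟩ := hasDerivAt_normSq hrate hcont hmild hdiv ht x
  refine ⟨hq, ?_⟩
  have hnt : 0 < -t := neg_pos.2 ht
  have h0 : fderiv ℝ (fun y => ⟪v t y, v t y⟫_ℝ) x ((fun (_ : ℝ) (_ : EuclideanSpace ℝ (Fin 3)) =>
      (0 : EuclideanSpace ℝ (Fin 3))) t x) = 0 := by simp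
  rw [h0, add_zero, hderiv, hL]
  have hcm : ⟪(Δ (v t)) x, v t x⟫_ℝ = ⟪v t x, (Δ (v t)) x⟫_ℝ := real_inner_comm _ _
  have hF := frobeniusNormSq_nonneg (fderiv ℝ (v t) x)
  have h1 := hle t ht x
  rw [inner_sub_right] at h1
  -- divide the hypothesis by `−t > 0`
  have h2 : ⟪v t x, deriv (fun τ => v τ x) t⟫_ℝ - ⟪v t x, (Δ (v t)) x⟫_ℝ ≤ κ / (-t) * ⟪v t x, v t x⟫_ℝ := by
    rw [div_mul_eq_mul_div, le_div_iff₀ hnt]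
    linarith
  have e : 2 * κ / (-t) * ⟪v t x, v t x⟫_ℝ = 2 * (κ / (-t) * ⟪v t x, v t x⟫_ℝ) := by ring
  rw [e]
  linarith [hcm]

/-- **The sub-critical head stratum is settled**: such a profile is not backward-singular. -/
theorem not_backwardSingular_of_subcritical_head (hrate : HasTypeITimeDecay C v)
    (hcont : ContinuousOn (uncurry v) (Iio (0 : ℝ) ×ˢ univ))
    (hmild : ∀ s t : ℝ, s < t → t < 0 → ∀ x,
      v t x = UnboundedOperators.heatExtension (v s) (t - s) x - oseenDuhamel 1 s v v t x)
    (hdiv : ∀ t < 0, VectorCalculus.IsDivFree (v t)) {κ : ℝ} (hκ : κ < 1 / 2)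
    (hle : ∀ s < 0, ∀ y, (-s) * ⟪v s y, deriv (fun τ => v τ y) s - (Δ (v s)) y⟫_ℝ ≤ κ * ⟪v s y, v s y⟫_ℝ) :
    ¬ IsBackwardSingularPoint v 0 :=
  not_backwardSingular_of_zero (eq_zero_of_subcritical_head hrate hcont hmild hdiv hκ hle)

end Summit.NavierStokesRegularity.NavierStokesRegularity.Theorems.LocalTraceTubeDoorSubcriticalEnergy

end
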